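/-
Origin: expansion seat `prover-pub-hodgecm-mc-binder-1-g15-0`, handover #R103 2026-08-20T19:15:16Z md5 64e48a52fbcd (140 l.; NEW additive universe-free datum-generic (p = 2) leaf; imports PKG #R94 Model/ClassLiftTwist + PKG #R95 Model/LevelCoverAlgebraic + Vendored ShimuraVarieties/UnitaryBallClassMapTranslate only; drop-alone (independent of #R100–#R102); NAME LIST: HodgeCM.Model.HeckeThetaClasses.pull_mem_thetaClasses_of_translate · HodgeCM.Model.HeckeThetaClasses.pull_heckeOpC_mem_span_thetaClasses) (`HOME/mc/pub-hodgecm-mc-binder-1-g15/stage60/HodgeCM/Model/HeckeThetaClasses.lean`, md5 64e48a52fbcd, 140 lines);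
landed by the second packager p2 gen 12 (p2-g12) in gate run 60 as `HodgeCM/Model/HeckeThetaClasses.lean` (verbatim).
-/
/-
Copyright (c) 2026 the pub-hodgecm formalisation cell (harness21).  New file, not vendored.
Origin: session prover-pub-hodgecm-mc-binder-1-g15-0 (unit pub-hodgecm-mc-binder-1-g15, BINDER PROVER gen 15 of lineage mc-binder-1;
content lane (J-Liu-Θ), scope memo `HOME/mc/pub-hodgecm-mc-binder-1-g14/JLIU-THETA-SCOPE.md` §9 (J2)/(J4), HECKE-TOWER sub-leaf (T9):
«theta classes pull back to theta classes along Hecke translates; `π^*(T_g ω)` is a combination of theta classes of the moved level»), 2026-08-20.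
Intended final place: `HodgeCM/Model/HeckeThetaClasses.lean` (NEW additive leaf, universe-free, datum-generic (p = 2); imports ONLY this lane's
`HodgeCM.Model.ClassLiftTwist` (#R94), `HodgeCM.Model.LevelCoverAlgebraic` (#R95) and the vendored twin `…ShimuraVarieties.UnitaryBallClassMapTranslate`;
nothing imports it; drops with #R94/#R95).
-/
import Summits.HodgeConjecture.HodgeCM.Model.ClassLiftTwist
import Summits.HodgeConjecture.HodgeCM.Model.LevelCoverAlgebraic
import Literature.AlgebraicGeometry.ShimuraVarieties.UnitaryBallClassMapTranslate

set_option autoImplicit false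

/-!
# Theta classes along Hecke translates: `π_g^* (theta class) = theta class`, and `π^*(T_g ω) ∈ span (theta classes)` at the moved level

The COHOMOLOGICAL form of the N33b dictionary (vendored `UnitaryBallClassMapTranslate`: for each `F ∈ Θ` a partner `F' ∈ Θ'` whose restricted group
function is the left `γ`-translate ⇒ a theta class `ω'` of `(D', Θ')` with `lift ω' = γ^*(lift ω)` EXISTS), sharpened by this lane's (α2)-twist
(#R94 `classLift_pull_mulVec`: for an ALGEBRAIC `f : X' ⟶ X` over the translate by `g`, `lift (f^* ω) = γ^*(lift ω)`, `γ = frameIso 𝔣 g`) and the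
injectivity of the class map on `F¹` (vendored `classPull_injOn_hodge_F`): the existential witness IS `f^* ω`.  So:

* `pull_mem_thetaClasses_of_translate` — **theta classes pull back to theta classes along a Hecke-translated level map** `f` (two adelic
  situations; hypothesis: every `F ∈ Θ` has a partner `F' ∈ Θ'` with restricted group function `x ↦ F|(γ x)`) — the `U(V)(F)`-STABILITY OF THETA
  CLASSES IN THE TOWER; `pull_mem_thetaClasses_of_rightTranslateHom` — the same with the partner = the vendored level-moving right translate
  `ThetaKernelDatum.rightTranslateHom … k⁻¹ …` under rationality data `(k, ιinf γ · k ∈ ΓU)` and stability `R(k⁻¹) Θ ⊆ Θ'`;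
* `pull_heckeOpC_mem_span_thetaClasses` — with #R95 `pull_heckeOpC_eq_sum`: for `ω` a theta class of `(D, Θ)` and an algebraic model
  `(XN', DN', π, π_q)` of the Hecke level cover whose translates carry theta classes of `Θ` to theta classes of `Θ'_q`,
  **`π^*(T_g ω) ∈ span ⋃_q thetaClasses (DN', Θ'_q)`** — the level-MOVING cohomological theta stability ((J2)+(J4) «π_N^*(T_g ω) is a combination of theta
  classes of the level pair moved to `N_g`», sinst-1's recommendation STATUS l.14121; the fixed-level form is theta-3's (R3) under (hQ)).

KIND: kernel theorems over vendored tree modules and this lane's leaves; nothing cited anew, nothing minted; 0 proof holes; expected `#print axioms`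
⊆ {propext, Classical.choice, Quot.sound}.

References: A. Borel (1997), §5.13–5.14; G. Shimura (1971), §3.3, §7.3, §8.3; C. Voisin (2002), §7.1.1 Cor. 7.6, §7.3.2.
-/

noncomputable section

open Matrix MulAction Function Set
open scoped TensorProduct
open CategoryTheory
open Literature.Geometry.ComplexHyperbolic
open Literature.Geometry.ComplexHyperbolic.BallModel (U21 Ball Jac x₀)
open Literature.NumberTheory.Automorphic
open Literature.NumberTheory.Automorphic.AutomorphyFactor
open Literature.AlgebraicGeometry.HodgeTheory
open Literature.AlgebraicGeometry.Motives (SchemeOver ComplexPoints AlgPoints bettiCohomology IsSmoothProjective)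

namespace HodgeCM.Model.HeckeThetaClasses

open Literature.AlgebraicGeometry.ShimuraVarieties UnitaryBallQuotientDatum
open HodgeCM.Model.ClassLiftTwist HodgeCM.Model.LevelCoverAlgebraic

/-! ### Theta classes pull back to theta classes along a translated level map -/

section Translate

variable {X X' : SchemeOver ℂ} (D : UnitaryBallUniformisationDatum 2 X) (D' : UnitaryBallUniformisationDatum 2 X')
  (hHD : exists_isReal_hodgeModel) (𝔣 : D.SylvesterFrame) (𝔣' : D'.SylvesterFrame) (hI : hodgePQ_independent_of_hodgeModel)
variable {GU GU' : Type*} [Group GU] [Group GU'] {Kc Kc' : Type*} [Group Kc] [Group Kc']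
variable {ΓU : Subgroup GU} {ΓU' : Subgroup GU'} {κ : Kc →* GU} {κ' : Kc' →* GU'}
variable {τ : Representation ℂ Kc (Fin 2 → ℂ)} {τ' : Representation ℂ Kc' (Fin 2 → ℂ)}
variable (ιinf : U21 →* GU) (ιinf' : U21 →* GU') {η₁ : stabilizer U21 x₀ →* Kc} {η₁' : stabilizer U21 x₀ →* Kc'}
variable (hΔ : WeightForms.IsLevelCorrected ΓU κ τ ιinf (D.ballImage 𝔣))
  (hη : WeightForms.IsWeightMatched κ τ ιinf (stabilizer U21 x₀).subtype (BallForms.isPullbackCocycle_cotangentCocycle.weightOf x₀) η₁)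
  (hΔ' : WeightForms.IsLevelCorrected ΓU' κ' τ' ιinf' (D'.ballImage 𝔣'))
  (hη' : WeightForms.IsWeightMatched κ' τ' ιinf' (stabilizer U21 x₀).subtype (BallForms.isPullbackCocycle_cotangentCocycle.weightOf x₀) η₁')

include hI in
/-- **Theta classes pull back to theta classes along a Hecke-translated level map** (two adelic situations): for an algebraic `f : X' ⟶ X` over
the translate by an isometry `g` (`f(ℂ)(unif' v) = unif (g v)`, frames agree, `γ := frameIso 𝔣 g`) and a theta class `ω` of `(D, Θ)`, if every
`F ∈ Θ` has a partner `F' ∈ Θ'` whose restricted group function is `x ↦ F|(γ x)`, then `f^* ω` is a theta class of `(D', Θ')`.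
[cite: Borel1997, §5.13–5.14] [cite: VoisinHodgeI2002, §7.1.1 Cor. 7.6 and §7.3.2] -/
theorem pull_mem_thetaClasses_of_translate (f : X' ⟶ X) (g : D.realPoints) (hT : 𝔣'.t = 𝔣.t)
    (hf : ∀ v ∈ D'.cone, AlgPoints.map f (D'.unif v) = D.unif (((g : GL (Fin 3) ℂ) : Matrix (Fin 3) (Fin 3) ℂ) *ᵥ v))
    (Θ : Submodule ℂ (weightForms ΓU κ τ)) (Θ' : Submodule ℂ (weightForms ΓU' κ' τ'))
    {ω : ℂ ⊗[ℚ] bettiCohomology X 1} (hω : ω ∈ WeightForms.thetaClasses ιinf (D.classMapDatum hHD 𝔣 hI ιinf hΔ hη) Θ)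
    (hΘ : ∀ F ∈ Θ, ∃ F' ∈ Θ', (WeightForms.restrictHom ιinf' hΔ' hη' F' : U21 → Fin 2 → ℂ) =
      fun x ↦ (WeightForms.restrictHom ιinf hΔ hη F : U21 → Fin 2 → ℂ) (D.frameIso 𝔣 g * x)) :
    (BettiUniverse.pull f 1).baseChange ℂ ω ∈ WeightForms.thetaClasses ιinf' (D'.classMapDatum hHD 𝔣' hI ιinf' hΔ' hη') Θ' := by
  -- the N33b witness
  obtain ⟨ω', hω', hlift⟩ := D.exists_mem_thetaClasses_classLift_eq_translate D' hHD 𝔣 𝔣' hI ιinf ιinf' hΔ hη hΔ' hη' Θ Θ'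
    (D.frameIso 𝔣 g) hω hΘ
  -- `f^* ω` has the same lift
  have hωF : ω ∈ (BettiUniverse.hodge hHD D.isSmoothProjective 1).F 1 := D.thetaClasses_subset_hodge_F hHD 𝔣 hI ιinf hΔ hη Θ hω
  have hpull := classLift_pull_mulVec (D := D) D' (f := f) (𝔣 := 𝔣) 𝔣' g hHD hI hT hf hωF
  -- both are in `F¹(X')`, where the class map is injective
  have hω'F : ω' ∈ (BettiUniverse.hodge hHD D'.isSmoothProjective 1).F 1 :=
    D'.thetaClasses_subset_hodge_F hHD 𝔣' hI ιinf' hΔ' hη' Θ' hω'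
  have hpF : (BettiUniverse.pull f 1).baseChange ℂ ω ∈ (BettiUniverse.hodge hHD D'.isSmoothProjective 1).F 1 :=
    BettiUniverse.pull_hodge hHD hI D'.isSmoothProjective D.isSmoothProjective f 1 1 (Submodule.mem_map_of_mem hωF)
  have heq : (BettiUniverse.pull f 1).baseChange ℂ ω = ω' := by
    refine D'.classPull_injOn_hodge_F hHD 𝔣' hI hpF hω'F ?_
    apply Subtype.ext
    rw [D'.coe_classPull, D'.coe_classPull, hpull, hlift]
  rw [heq]
  exact hω'

end Translate

/-! ### `π^*(T_g ω)` is a combination of theta classes of the moved level -/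

section Hecke

variable {X XN' : SchemeOver ℂ} {D : UnitaryBallQuotientDatum 2 X} {g : GL (Fin 3) D.E} (h : D.IsHeckeAdmissible g)
  (DN' : UnitaryBallUniformisationDatum 2 XN') (hH' : DN'.Hℂ = D.Hℂ)
  (hΓ' : DN'.Γ.map (Matrix.GeneralLinearGroup.map DN'.τ₁) = ((D.heckeLevel g).map D.Γ.subtype).map (Matrix.GeneralLinearGroup.map D.τ₁))
  (hHD : exists_isReal_hodgeModel) (hI : hodgePQ_independent_of_hodgeModel) (𝔣' : DN'.SylvesterFrame)
variable {GU' : Type*} [Group GU'] {Kc' : Type*} [Group Kc'] {ΓU' : Subgroup GU'} {κ' : Kc' →* GU'} {τ' : Representation ℂ Kc' (Fin 2 → ℂ)}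
  (ιinf' : U21 →* GU') {η₁' : stabilizer U21 x₀ →* Kc'}
  (hΔ' : WeightForms.IsLevelCorrected ΓU' κ' τ' ιinf' (DN'.ballImage 𝔣'))
  (hη' : WeightForms.IsWeightMatched κ' τ' ιinf' (stabilizer U21 x₀).subtype (BallForms.isPullbackCocycle_cotangentCocycle.weightOf x₀) η₁')

include h hH' hΓ' in
/-- **Level-moving cohomological theta stability**: for `g` admissible, an algebraic model `(XN', DN', π, π_q)` of the Hecke level cover, and
`x ∈ ℂ ⊗ H¹(X(ℂ);ℚ)` whose translates `π_q^* x` are theta classes of `(DN', Θ'_q)` for every `q ∈ Γ/N_g`, the pulled-back Hecke image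
`π^*(T_g x)` lies in the span of the theta classes `⋃_q thetaClasses (DN', Θ'_q)` (#R95 `pull_heckeOpC_eq_sum`). [cite: Shimura1973, §3.3 and §8.3] -/
theorem pull_heckeOpC_mem_span_thetaClasses {n : ℕ} (hX : IsSmoothProjective n X) (π : XN' ⟶ X)
    (hπ : ∀ v ∈ DN'.cone, AlgPoints.map π (DN'.unif v) = D.unif v)
    (πq : ↥D.Γ ⧸ D.heckeLevel g → (XN' ⟶ X))
    (hπq : ∀ q, ∀ v ∈ DN'.cone, v ∈ D.cone →
      AlgPoints.map (πq q) (DN'.unif v) = D.unif (D.act (g * ((Quotient.out q : ↥D.Γ) : GL (Fin 3) D.E)) v))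
    (Θ' : ↥D.Γ ⧸ D.heckeLevel g → Submodule ℂ (weightForms ΓU' κ' τ')) {x : ℂ ⊗[ℚ] bettiCohomology X 1}
    (hx : ∀ q, (BettiUniverse.pull (πq q) 1).baseChange ℂ x ∈ WeightForms.thetaClasses ιinf' (DN'.classMapDatum hHD 𝔣' hI ιinf' hΔ' hη') (Θ' q)) :
    (BettiUniverse.pull π 1).baseChange ℂ (heckeOpC D hX 1 g x) ∈
      Submodule.span ℂ (⋃ q, WeightForms.thetaClasses ιinf' (DN'.classMapDatum hHD 𝔣' hI ιinf' hΔ' hη') (Θ' q)) := by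
  haveI : (D.heckeLevel g).FiniteIndex := h.finiteIndex
  letI : Fintype (↥D.Γ ⧸ D.heckeLevel g) := Subgroup.fintypeQuotientOfFiniteIndex
  have hsum := pull_heckeOpC_eq_sum h DN' hH' hΓ' hX π hπ πq hπq 1 x
  rw [hsum]
  refine Submodule.smul_mem _ _ (Submodule.sum_mem _ fun q _ ↦ Submodule.subset_span ?_)
  exact Set.mem_iUnion.2 ⟨q, hx q⟩

end Hecke

end HodgeCM.Model.HeckeThetaClasses

end
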